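import Summits.CriticalPhenomena.PercolationContinuityZ3.Theorems.PercAnnulusCrossingSlabThm31OfH316
import Literature.Probability.Percolation.SlabRSWSnapLemma316
import HarnessLib

/-!
# NTW 2017, Theorem 3.1 at `p_c(S_k)` from ONE combinatorial input: local gadgets for the coarse-grained
# gluing datum `snapGlue` of Lemma 3.16

builds on p205010 (kernel theorem, internal audit signed; external expert review pending) — NOT used in this file.

Cell `prim-rsw3` (LANE 3), lead GEN 40.  Support file (`--supports stmt-CriticalPhenomena-4575`); no definitions, no named
facts, no sorries.  Composition of `NewmanTassionWu2017_thm31_of_h316` (GEN 39: Thm 3.1 ⇐ (H316), every other input of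
NTW §3 discharged in the tree) with `NTW17.h316_of_snapGadgets'` (this gen: (H316) at `ρ₂ = 60` ⇐ separation, crossing,
Harris and the linear gluing bound for p1's coarse-grained datum `NTW17.snapGlue`, whose obstacle `N(Γ)` is a union of
mesh-`40` lattice tiles — the coarse-graining of NTW's `K_□`).  After this file, `NewmanTassionWu2017_thm31_holds` rests on exactly one purely
combinatorial statement per thickness `k`: the gadget supply (SG) below (p1 GEN 31's `exists_gadget₂`, in progress).

* `boxCrossingProperty_slabCritical_of_snapGadgets'` / `…_of_snapGadgets` — `BoxCrossingProperty k (p_c(S_k))` from (SG) for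
  that `k` (admissible form / `A ⟷^{S'} B`-only form);
* **`NewmanTassionWu2017_thm31_of_snapGadgets'`** / **`NewmanTassionWu2017_thm31_of_snapGadgets`** — the named fact from
  (SG) for every `k ≥ 1` (radii `ρ`, `r` and threshold `n₀` may depend on `k`); `…_uniform` — the same with `ρ`, `r`, `n₀`
  uniform in `k`; `…_box` — the supply asked for `snapGlue k n hn Γ` and every vertex list `Γ` with cells in `S'`.

References: C. M. Newman, V. Tassion, W. Wu, *Critical percolation and the minimal spanning tree in slabs*, Comm. Pure Appl. Math. 70
(2017) = arXiv:1512.09107, Theorem 3.1, §3.5 (Theorem 3.14 Case 3, Lemma 3.16: "the domain `K_□` is regular enough to apply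
Theorem 3.6"), §3.2 (Remark 2 after Theorem 3.7), §3.7 [NewmanTassionWu2017].
-/

noncomputable section

namespace Summit.CriticalPhenomena.PercolationContinuityZ3.Theorems.Crossing

open MeasureTheory
open Literature.Probability.Percolation Literature.Probability.LatticeModels
open Literature.Probability.Percolation.NTW17

/-- `0 < p_c(S_k) < 1` as real numbers. [cite: NewmanTassionWu2017, §3.1 (p_c(S_k) ∈ (0,1))] -/
theorem criticalProb_slab_pos_lt_one (k : ℕ) :
    0 < ((criticalProbIOf (slabGraph 3 k) (slabOrigin 3 k) : unitInterval) : ℝ) ∧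
      ((criticalProbIOf (slabGraph 3 k) (slabOrigin 3 k) : unitInterval) : ℝ) < 1 := by
  constructor
  · show 0 < criticalProb (slabGraph 3 k) (slabOrigin 3 k)
    exact (criticalProb_zd_pos 3 (by norm_num)).trans
      (AizenmanGrimmett1991.criticalProb_zd_lt_criticalProb_slab_of_AG (d := 3) le_rfl k)
  · show criticalProb (slabGraph 3 k) (slabOrigin 3 k) < 1
    exact (Transplant.StairSlabLog.criticalProb_slab_le_half k).trans_lt (by norm_num)

/-- **The box-crossing property at `p_c(S_k)` from local gadgets for `snapGlue`, admissible form (SG').**  For `k ≥ 1`,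
radii `ρ`, `r` and a threshold `n₀`: if for every `n ≥ n₀` (`n ≥ 1`), every admissible lattice configuration `ω` of the
reflected frame `case2Setup n` (`A ⟷^{S'} B`, `𝖡 ⟷^{R'} C`, not `C ⟷^{R'} A`, not `C̄ ⟷^{R̄'} 𝒩(Γ̄, 60)`) and every lattice
`ω' ∈ Q₂.evXn ρ`, `Q₂ = snapGlue k n hn (Γ ω)`, a local modification `GadgetSpec Q₂ k r ω' ω''` exists, then
`BoxCrossingProperty k (p_c(S_k))`.
[cite: NewmanTassionWu2017, Theorem 3.1 with Theorem 3.14 (Case 3), Lemma 3.16, Theorem 3.6 (Remark 2) and §3.7] -/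
theorem boxCrossingProperty_slabCritical_of_snapGadgets' (k : ℕ) (hk : 1 ≤ k) {ρ r n₀ : ℕ}
    (hgad : ∀ (n : ℕ) (hn : 1 ≤ n), n₀ ≤ n → ∀ ω : BondConfig (slab 3 k), ω ⊆ (slabGraph 3 k).edgeSet →
      ω ∈ (case2Setup n hn).Q.evAB k → ω ∈ slabConn k (case2Setup n hn).R {z | z.2 = 0} (case2Setup n hn).C →
      ω ∉ (case2Setup n hn).Q.evCA k → ω ∉ (case2Setup n hn).Q.evNear k 60 →
      ∀ ω' : BondConfig (slab 3 k), ω' ⊆ (slabGraph 3 k).edgeSet →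
      ω' ∈ (snapGlue k n hn ((case2Setup n hn).Q.γ k ω)).evXn k ρ →
      ∃ ω'', GadgetSpec (snapGlue k n hn ((case2Setup n hn).Q.γ k ω)) k r ω' ω'') :
    BoxCrossingProperty k (criticalProbIOf (slabGraph 3 k) (slabOrigin 3 k)) :=
  boxCrossingProperty_slabCritical_of_h316 k hk (by norm_num : 2 ≤ 60)
    (h316_of_snapGadgets' _ (criticalProb_slab_pos_lt_one k).1 (criticalProb_slab_pos_lt_one k).2 hgad)

/-- **The box-crossing property at `p_c(S_k)` from local gadgets for `snapGlue` (SG).**  As the primed version, with the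
gadget supply asked for every lattice `ω` with `A ⟷^{S'} B` only.
[cite: NewmanTassionWu2017, Theorem 3.1 with Theorem 3.14 (Case 3), Lemma 3.16, Theorem 3.6 (Remark 2) and §3.7] -/
theorem boxCrossingProperty_slabCritical_of_snapGadgets (k : ℕ) (hk : 1 ≤ k) {ρ r n₀ : ℕ}
    (hgad : ∀ (n : ℕ) (hn : 1 ≤ n), n₀ ≤ n → ∀ ω : BondConfig (slab 3 k), ω ⊆ (slabGraph 3 k).edgeSet →
      ω ∈ (case2Setup n hn).Q.evAB k → ∀ ω' : BondConfig (slab 3 k), ω' ⊆ (slabGraph 3 k).edgeSet →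
      ω' ∈ (snapGlue k n hn ((case2Setup n hn).Q.γ k ω)).evXn k ρ →
      ∃ ω'', GadgetSpec (snapGlue k n hn ((case2Setup n hn).Q.γ k ω)) k r ω' ω'') :
    BoxCrossingProperty k (criticalProbIOf (slabGraph 3 k) (slabOrigin 3 k)) :=
  boxCrossingProperty_slabCritical_of_snapGadgets' k hk fun n hn hn₀ ω hω hAB _ _ _ => hgad n hn hn₀ ω hω hAB

/-- **`NewmanTassionWu2017_thm31` from the gadget supply for `snapGlue`, admissible form, for every `k ≥ 1`** (radii and
threshold depending on `k`). [cite: NewmanTassionWu2017, Theorem 3.1 and §3.7, with Theorem 3.14 Case 3 and Lemma 3.16] -/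
theorem NewmanTassionWu2017_thm31_of_snapGadgets'
    (hgad : ∀ k : ℕ, 1 ≤ k → ∃ ρ r n₀ : ℕ, ∀ (n : ℕ) (hn : 1 ≤ n), n₀ ≤ n →
      ∀ ω : BondConfig (slab 3 k), ω ⊆ (slabGraph 3 k).edgeSet →
      ω ∈ (case2Setup n hn).Q.evAB k → ω ∈ slabConn k (case2Setup n hn).R {z | z.2 = 0} (case2Setup n hn).C →
      ω ∉ (case2Setup n hn).Q.evCA k → ω ∉ (case2Setup n hn).Q.evNear k 60 →
      ∀ ω' : BondConfig (slab 3 k), ω' ⊆ (slabGraph 3 k).edgeSet →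
      ω' ∈ (snapGlue k n hn ((case2Setup n hn).Q.γ k ω)).evXn k ρ →
      ∃ ω'', GadgetSpec (snapGlue k n hn ((case2Setup n hn).Q.γ k ω)) k r ω' ω'') :
    NewmanTassionWu2017_thm31 := by
  intro k hk
  obtain ⟨ρ, r, n₀, h⟩ := hgad k hk
  exact boxCrossingProperty_slabCritical_of_snapGadgets' k hk h

/-- **`NewmanTassionWu2017_thm31` from the gadget supply (SG) for `snapGlue`, for every `k ≥ 1`** (radii and threshold
depending on `k`). [cite: NewmanTassionWu2017, Theorem 3.1 and §3.7, with Theorem 3.14 Case 3 and Lemma 3.16] -/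
theorem NewmanTassionWu2017_thm31_of_snapGadgets
    (hgad : ∀ k : ℕ, 1 ≤ k → ∃ ρ r n₀ : ℕ, ∀ (n : ℕ) (hn : 1 ≤ n), n₀ ≤ n →
      ∀ ω : BondConfig (slab 3 k), ω ⊆ (slabGraph 3 k).edgeSet →
      ω ∈ (case2Setup n hn).Q.evAB k → ∀ ω' : BondConfig (slab 3 k), ω' ⊆ (slabGraph 3 k).edgeSet →
      ω' ∈ (snapGlue k n hn ((case2Setup n hn).Q.γ k ω)).evXn k ρ →
      ∃ ω'', GadgetSpec (snapGlue k n hn ((case2Setup n hn).Q.γ k ω)) k r ω' ω'') :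
    NewmanTassionWu2017_thm31 := by
  intro k hk
  obtain ⟨ρ, r, n₀, h⟩ := hgad k hk
  exact boxCrossingProperty_slabCritical_of_snapGadgets k hk h

/-- **`NewmanTassionWu2017_thm31` from a gadget supply with radii and threshold UNIFORM in `k`** (the form of p1's
construction: `ρ = 1`, `r = 14`, `n₀ = 19` for every thickness).
[cite: NewmanTassionWu2017, Theorem 3.1 and §3.7, with Theorem 3.14 Case 3 and Lemma 3.16] -/
theorem NewmanTassionWu2017_thm31_of_snapGadgets_uniform {ρ r n₀ : ℕ}
    (hgad : ∀ k : ℕ, 1 ≤ k → ∀ (n : ℕ) (hn : 1 ≤ n), n₀ ≤ n →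
      ∀ ω : BondConfig (slab 3 k), ω ⊆ (slabGraph 3 k).edgeSet →
      ω ∈ (case2Setup n hn).Q.evAB k → ∀ ω' : BondConfig (slab 3 k), ω' ⊆ (slabGraph 3 k).edgeSet →
      ω' ∈ (snapGlue k n hn ((case2Setup n hn).Q.γ k ω)).evXn k ρ →
      ∃ ω'', GadgetSpec (snapGlue k n hn ((case2Setup n hn).Q.γ k ω)) k r ω' ω'') :
    NewmanTassionWu2017_thm31 :=
  NewmanTassionWu2017_thm31_of_snapGadgets fun k hk => ⟨ρ, r, n₀, hgad k hk⟩

/-- **`NewmanTassionWu2017_thm31` from a gadget supply for `snapGlue Γ`, every vertex list `Γ` with cells in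
`S' = [0,7n]×[0,8n-1]`, radii and threshold uniform in `k`.**
[cite: NewmanTassionWu2017, Theorem 3.1 and §3.7, with Theorem 3.14 Case 3 and Lemma 3.16] -/
theorem NewmanTassionWu2017_thm31_of_snapGadgets_box {ρ r n₀ : ℕ}
    (hgad : ∀ k : ℕ, 1 ≤ k → ∀ (n : ℕ) (hn : 1 ≤ n), n₀ ≤ n → ∀ Γ : List (slab 3 k),
      (∀ g ∈ Γ, planar k g ∈ boxR 0 (7 * n) 0 (8 * n - 1)) →
      ∀ ω' : BondConfig (slab 3 k), ω' ⊆ (slabGraph 3 k).edgeSet →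
      ω' ∈ (snapGlue k n hn Γ).evXn k ρ → ∃ ω'', GadgetSpec (snapGlue k n hn Γ) k r ω' ω'') :
    NewmanTassionWu2017_thm31 :=
  NewmanTassionWu2017_thm31_of_snapGadgets_uniform (ρ := ρ) (r := r) (n₀ := n₀) fun k hk n hn hn₀ _ _ hAB =>
    hgad k hk n hn hn₀ _ fun g hg => ((case2Setup n hn).Q.γ_spec hAB).1.subset g hg

end Summit.CriticalPhenomena.PercolationContinuityZ3.Theorems.Crossing

end
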